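import Literature.Topology.FourManifolds.PairPreExt
import HarnessLib

/-!
# Pre-extension maps of a pair of basin settings: the corrected map near the minimum and the
# extension `pull_B ∘ Ψ₁ ∘ push_A`

Topic `Literature/Topology/FourManifolds` (support file for the two-field handle-extension
endgame of `stmt-SmoothPoincare4-15190`; the two-field analogue of `BasinExtension.lean`).
Everything here is **proved**; the new definitions are the corrected map and the extension.

For a pair of basin settings `P`, a boundary map `χ` and a pre-extension half
`E : P.PreHalf χ` (`PairPreExt.lean`), and a map `Θ` of the model space which preserves the norm
and is the cone over `E.sphereMap` on the shell `rad/2 ≤ ‖·‖ ≤ rad` (Cerf's radial extension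
of a diffeotopy of the sphere of directions, supplied in dimension `3` by
`ConeRadialExtension.lean`):

* `PreHalf.psi₁ E Θ` — **the corrected map `Ψ₁`**: the chart conjugate of `Θ` inside the ball
  `{g < sphR}`, the half `E.ψ` outside; it preserves the levels below `hi`, equals `E.ψ` off the
  inner ball, is smooth below `hi`, is inverted by the corrected map of inverse data, and sends
  `push_A y` to `push_B (χ y)` (`psi₁_push_coe`, from `ψ = transportAB χ` on `L`);
* `PreHalf.ext E Θ = pull_B ∘ Ψ₁ ∘ push_A` — **the extension**: it restricts to `χ` on `∂W`
  (`ext_coe`), is smooth (`contMDiff_ext`) and is inverted by the extension of inverse data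
  (`ext_ext`); `PreHalf.extDiffeomorph` packages a mutually inverse pair as a diffeomorphism of
  `W`.

## References

* H. B. Griffiths, *Automorphisms of a 3-dimensional handlebody*, Abh. Math. Sem. Univ. Hamburg
  26 (1964), main theorem and §§3–6. [GriffithsHB1964Handlebody]
* J. Cerf, *Sur les difféomorphismes de la sphère de dimension trois (Γ₄ = 0)*, LNM 53 (1968),
  Ch. I §1, Lemme 2. [CerfDiffeoSphere1968]
-/

open scoped Manifold ContDiff Topology
open Set Function Filter Metric

noncomputable section

namespace Literature.Topology.FourManifolds

open Cobordism FourManifolds.Flow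

universe u

variable {n : ℕ} {W : Type u} [TopologicalSpace W] [T2Space W] [SecondCountableTopology W]
  [CompactSpace W] [ChartedSpace (EuclideanHalfSpace (n + 1)) W] [IsManifold (𝓡∂ (n + 1)) ∞ W]
  [Nonempty (BoundaryManifold.boundaryData n W).carrier]

namespace BasinPair

attribute [local instance] fact_finrank_euclideanSpace_succ

variable {g : W → ℝ} {ξA ξB : Π x : W, TangentSpace (𝓡∂ (n + 1)) x} {P : BasinPair g ξA ξB}

omit [Nonempty (BoundaryManifold.boundaryData n W).carrier] in
/-- `sphR` of the swapped pair is `sphR`. [folklore] -/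
theorem sphR_swap (P : BasinPair g ξA ξB) : P.swap.A.sphR = P.A.sphR := by
  show P.B.sphR = P.A.sphR
  unfold BasinSetting.sphR BasinSetting.rad; rw [P.p₀_eq, P.r₀_eq]

omit [Nonempty (BoundaryManifold.boundaryData n W).carrier] in
/-- `g p₀ < sphR'`. [folklore] -/
theorem apply_p₀_lt_sphR' (P : BasinPair g ξA ξB) : g P.A.p₀ < P.A.sphR' := by
  unfold BasinSetting.sphR'; have := P.A.rad_pos; nlinarith

namespace PreHalf

variable {χ χ' : (𝓡∂ (n + 1)).boundary W → (𝓡∂ (n + 1)).boundary W} (E : P.PreHalf χ)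
  {Θ Θ' : EuclideanSpace ℝ (Fin (n + 1)) → EuclideanSpace ℝ (Fin (n + 1))}

/-! ### The corrected map near the minimum -/

open scoped Classical in
/-- **The corrected map `Ψ₁`**: inside the ball `{g < sphR}` the chart conjugate of `Θ`, outside
it the half `ψ`. [cite: GriffithsHB1964Handlebody, §§3–6] [cite: CerfDiffeoSphere1968, Ch. I §1, Lemme 2] -/
def psi₁ (Θ : EuclideanSpace ℝ (Fin (n + 1)) → EuclideanSpace ℝ (Fin (n + 1))) (x : W) : W :=
  if g x < P.A.sphR then P.A.ofChart (Θ (P.A.toChart x)) else E.ψ x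

/-- `psi₁` inside the ball. [folklore] -/
theorem psi₁_of_lt {x : W} (hx : g x < P.A.sphR) : E.psi₁ Θ x = P.A.ofChart (Θ (P.A.toChart x)) := by
  unfold psi₁; rw [if_pos hx]

/-- `psi₁` outside the ball. [folklore] -/
theorem psi₁_of_le {x : W} (hx : P.A.sphR ≤ g x) : E.psi₁ Θ x = E.ψ x := by
  unfold psi₁; rw [if_neg (not_lt.2 hx)]

omit [Nonempty (BoundaryManifold.boundaryData n W).carrier] in
/-- Points with `sphR ≤ g x < hi` have level in `(g p₀, hi)`. [folklore] -/
theorem mem_Ioo_of_sphR_le {x : W} (hx : P.A.sphR ≤ g x) (hx' : g x < P.A.hi) : g x ∈ Ioo (g P.A.p₀) P.A.hi :=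
  ⟨(apply_p₀_lt_sphR' P).trans (P.A.sphR'_lt_sphR.trans_le hx), hx'⟩

section Cone

-- `Θ` preserves the norm ...
variable (hΘn : ∀ v, ‖Θ v‖ = ‖v‖)
-- ... and is the cone over `E.sphereMap` on the shell `rad / 2 ≤ t ≤ rad`.
variable (hΘc : ∀ (t : ℝ) (u : Metric.sphere (0 : EuclideanSpace ℝ (Fin (n + 1))) 1), P.A.rad / 2 ≤ t → t ≤ P.A.rad →
    Θ (t • (u : EuclideanSpace ℝ (Fin (n + 1)))) =
      t • ((E.sphereMap u : Metric.sphere (0 : EuclideanSpace ℝ (Fin (n + 1))) 1) : EuclideanSpace ℝ (Fin (n + 1))))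

include hΘn in
/-- **`psi₁` preserves the levels below `hi`.** [folklore] -/
theorem apply_psi₁ {x : W} (hx : g x < P.A.hi) : g (E.psi₁ Θ x) = g x := by
  by_cases hx' : g x < P.A.sphR
  · have hxs : g x ≤ P.A.sph := (hx'.trans P.A.sphR_lt_sph).le
    have hv : ‖P.A.toChart x‖ ≤ P.A.r₀ := P.A.norm_toChart_le hxs
    rw [E.psi₁_of_lt hx', P.A.apply_ofChart (by rw [hΘn]; exact hv), hΘn, P.A.norm_toChart_sq hxs]; ring
  · rw [E.psi₁_of_le (not_lt.1 hx'), E.apply_ψ x (mem_Ioo_of_sphR_le (not_lt.1 hx') hx)]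

include hΘc in
/-- **On the shell the chart conjugate of `Θ` is `ψ`**: for `rad/2 ≤ ‖toChart x‖ ≤ rad`,
`ofChart (Θ (toChart x)) = ψ x`. [cite: GriffithsHB1964Handlebody, §§3–6] -/
theorem ofChart_Θ_toChart_eq_ψ {x : W} (hx : g x ≤ P.A.sph) (h1 : P.A.rad / 2 ≤ ‖P.A.toChart x‖)
    (h2 : ‖P.A.toChart x‖ ≤ P.A.rad) : P.A.ofChart (Θ (P.A.toChart x)) = E.ψ x := by
  set v := P.A.toChart x with hv
  have hv0 : v ≠ 0 := fun h => by rw [h, norm_zero] at h1; linarith [P.A.rad_pos]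
  have hvn : 0 < ‖v‖ := norm_pos_iff.2 hv0
  set u : Metric.sphere (0 : EuclideanSpace ℝ (Fin (n + 1))) 1 := ⟨‖v‖⁻¹ • v, by
    rw [mem_sphere_zero_iff_norm, norm_smul, norm_inv, norm_norm, inv_mul_cancel₀ hvn.ne']⟩ with hu
  have hvu : v = ‖v‖ • (u : EuclideanSpace ℝ (Fin (n + 1))) := by
    show v = ‖v‖ • (‖v‖⁻¹ • v); rw [smul_smul, mul_inv_cancel₀ hvn.ne', one_smul]
  have hxv : P.A.ofChart v = x := P.A.ofChart_toChart_of_apply_le hx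
  have hxp : g P.A.p₀ < g x := by
    have h3 := P.A.norm_toChart_sq hx; rw [← hv] at h3; nlinarith
  rw [hvu, hΘc _ u h1 h2, ← E.coneFun_smul_coe hvn h2 u, ← hvu, coneFun_def, hxv, P.A.ofChart_toChart_of_apply_le]
  exact (E.apply_ψ_lt_sph hxp (lt_of_le_of_ne hx fun h => by
    -- `g x = sph` would give `‖toChart x‖ = r₀ > rad`
    have h3 := P.A.norm_toChart_sq hx
    rw [h] at h3; unfold BasinSetting.sph at h3
    have h4 : ‖P.A.toChart x‖ ^ 2 ≤ P.A.rad ^ 2 := pow_le_pow_left₀ (norm_nonneg _) h2 2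
    have := P.A.rad_lt_r₀; have := P.A.rad_pos
    nlinarith)).le

include hΘc in
/-- **`psi₁ = ψ` off the inner ball** `{g < sphR'}`. [folklore] -/
theorem psi₁_eq_ψ_of_le {x : W} (hx : P.A.sphR' ≤ g x) : E.psi₁ Θ x = E.ψ x := by
  by_cases hx' : g x < P.A.sphR
  · rw [E.psi₁_of_lt hx']
    have hxs : g x ≤ P.A.sph := (hx'.trans P.A.sphR_lt_sph).le
    refine E.ofChart_Θ_toChart_eq_ψ hΘc hxs ?_ ?_
    · have h := (P.A.apply_lt_iff_norm_toChart_lt hxs (by linarith [P.A.rad_pos] : (0 : ℝ) ≤ P.A.rad / 2)).not.1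
        (by unfold BasinSetting.sphR' at hx; exact not_lt.2 hx)
      exact not_lt.1 h
    · exact ((P.A.apply_lt_iff_norm_toChart_lt hxs P.A.rad_pos.le).1 hx').le
  · exact E.psi₁_of_le (not_lt.1 hx')

include hΘn in
/-- **The corrected map of inverse data inverts the corrected map** below `hi`. [folklore] -/
theorem psi₁_psi₁ (E' : P.swap.PreHalf χ') (hinv : ∀ x, g x ∈ Ioo (g P.A.p₀) P.A.hi → E'.ψ (E.ψ x) = x)
    (hΘ : LeftInverse Θ' Θ) {x : W} (hx : g x < P.A.hi) : E'.psi₁ Θ' (E.psi₁ Θ x) = x := by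
  have hlev := E.apply_psi₁ hΘn hx
  by_cases hx' : g x < P.A.sphR
  · have hxs : g x ≤ P.A.sph := (hx'.trans P.A.sphR_lt_sph).le
    rw [E'.psi₁_of_lt (by rw [sphR_swap, hlev]; exact hx'), E.psi₁_of_lt hx', swap_A, P.ofChart_eq, P.toChart_eq,
      P.A.toChart_ofChart (by rw [hΘn]; exact P.A.norm_toChart_le hxs), hΘ, P.A.ofChart_toChart_of_apply_le hxs]
  · rw [E'.psi₁_of_le (by rw [sphR_swap, hlev]; exact not_lt.1 hx'), E.psi₁_of_le (not_lt.1 hx'),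
      hinv x (mem_Ioo_of_sphR_le (not_lt.1 hx') hx)]

include hΘc in
/-- **`psi₁` is smooth at every point of `{g < hi}`**, for `Θ` smooth and norm-preserving:
inside `{g < sphR}` it is the chart conjugate of `Θ`, on `{sphR' < g < hi}` it is `ψ`. [cite: GriffithsHB1964Handlebody, §§3–6] [cite: CerfDiffeoSphere1968, Ch. I §1, Lemme 2] -/
theorem contMDiffAt_psi₁ (hΘs : ContMDiff 𝓘(ℝ, EuclideanSpace ℝ (Fin (n + 1))) 𝓘(ℝ, EuclideanSpace ℝ (Fin (n + 1))) ∞ Θ)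
    (hΘn : ∀ v, ‖Θ v‖ = ‖v‖) {x : W} (hxm : g x < P.A.hi) :
    ContMDiffAt (𝓡∂ (n + 1)) (𝓡∂ (n + 1)) ∞ (E.psi₁ Θ) x := by
  have hgc : Continuous g := P.A.isMorseFunction.isMorse.contMDiff.continuous
  by_cases hx : g x < P.A.sphR
  · -- inside the ball: the chart conjugate of `Θ`
    have hxs : g x ≤ P.A.sph := (hx.trans P.A.sphR_lt_sph).le
    have hev : E.psi₁ Θ =ᶠ[𝓝 x] fun z => P.A.ofChart (Θ (P.A.toChart z)) := by
      filter_upwards [(isOpen_lt hgc continuous_const).mem_nhds hx] with z hz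
      exact E.psi₁_of_lt hz
    refine ContMDiffAt.congr_of_eventuallyEq ?_ hev
    have hnorm : ‖Θ (P.A.toChart x)‖ < P.A.r₀ := by
      rw [hΘn]; exact lt_of_lt_of_le ((P.A.apply_lt_iff_norm_toChart_lt hxs P.A.rad_pos.le).1 hx) P.A.rad_lt_r₀.le
    have h1 : ContMDiffAt (𝓡∂ (n + 1)) 𝓘(ℝ, EuclideanSpace ℝ (Fin (n + 1))) ∞ (Θ ∘ P.A.toChart) x :=
      hΘs.contMDiffAt.comp x (P.A.contMDiffAt_toChart (P.A.mem_source_of_apply_le hxs))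
    have h2 : ContMDiffAt (𝓡∂ (n + 1)) (𝓡∂ (n + 1)) ∞ (P.A.ofChart ∘ (Θ ∘ P.A.toChart)) x :=
      (BasinSetting.contMDiffAt_ofChart hnorm).comp x h1
    exact h2
  · -- outside the inner ball: `ψ`
    have hx' : P.A.sphR' < g x := P.A.sphR'_lt_sphR.trans_le (not_lt.1 hx)
    have hev : E.psi₁ Θ =ᶠ[𝓝 x] E.ψ := by
      filter_upwards [(isOpen_lt continuous_const hgc).mem_nhds hx'] with z hz
      exact E.psi₁_eq_ψ_of_le hΘc hz.le
    refine ContMDiffAt.congr_of_eventuallyEq ?_ hev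
    exact E.contMDiffAt_ψ x ⟨(apply_p₀_lt_sphR' P).trans hx', hxm⟩

end Cone

/-- **`psi₁` on the push of a boundary point**: `psi₁ (push_A y) = push_B (χ y)`. [cite: GriffithsHB1964Handlebody, §§3–6] -/
theorem psi₁_push_coe (y : (𝓡∂ (n + 1)).boundary W) : E.psi₁ Θ (P.A.push (y : W)) = P.B.push (χ y : W) := by
  have hL : g (P.A.push (y : W)) = P.A.L := P.A.apply_push_coe y
  rw [E.psi₁_of_le (by rw [hL]; exact (P.A.sphR_lt_sph.trans P.A.sph_lt_L).le), E.ψ_L _ hL, P.transportAB_push_coe]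

/-! ### The extension -/

/-- **The extension** `Ψ = pull_B ∘ Ψ₁ ∘ push_A`. [cite: GriffithsHB1964Handlebody, §§3–6] -/
def ext (Θ : EuclideanSpace ℝ (Fin (n + 1)) → EuclideanSpace ℝ (Fin (n + 1))) (x : W) : W :=
  P.B.pull (E.psi₁ Θ (P.A.push x))

/-- Unfolding `ext`. [folklore] -/
theorem ext_def (Θ : EuclideanSpace ℝ (Fin (n + 1)) → EuclideanSpace ℝ (Fin (n + 1))) (x : W) :
    E.ext Θ x = P.B.pull (E.psi₁ Θ (P.A.push x)) := rfl

/-- **The extension restricts to `χ` on `∂W`.** [cite: GriffithsHB1964Handlebody, main theorem] -/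
theorem ext_coe (y : (𝓡∂ (n + 1)).boundary W) : E.ext Θ (y : W) = (χ y : W) := by
  rw [ext_def, E.psi₁_push_coe, P.B.pull_push]

/-- **The extension of inverse data inverts the extension.** [folklore] -/
theorem ext_ext (hΘn : ∀ v, ‖Θ v‖ = ‖v‖) (E' : P.swap.PreHalf χ')
    (hinv : ∀ x, g x ∈ Ioo (g P.A.p₀) P.A.hi → E'.ψ (E.ψ x) = x) (hΘ : LeftInverse Θ' Θ) (x : W) :
    E'.ext Θ' (E.ext Θ x) = x := by
  have hle : g (P.A.push x) ≤ P.A.L := P.A.apply_push_le x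
  have hlt : g (P.A.push x) < P.A.hi := hle.trans_lt P.A.L_lt_hi
  rw [ext_def, ext_def, swap_A, swap_B, P.B.push_pull, E.psi₁_psi₁ hΘn E' hinv hΘ hlt, P.A.pull_push]
  rw [E.apply_psi₁ hΘn hlt, P.L_eq]; exact hle

/-- **The extension is smooth.** [cite: GriffithsHB1964Handlebody, §§3–6] -/
theorem contMDiff_ext
    (hΘs : ContMDiff 𝓘(ℝ, EuclideanSpace ℝ (Fin (n + 1))) 𝓘(ℝ, EuclideanSpace ℝ (Fin (n + 1))) ∞ Θ)
    (hΘn : ∀ v, ‖Θ v‖ = ‖v‖)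
    (hΘc : ∀ (t : ℝ) (u : Metric.sphere (0 : EuclideanSpace ℝ (Fin (n + 1))) 1), P.A.rad / 2 ≤ t → t ≤ P.A.rad →
      Θ (t • (u : EuclideanSpace ℝ (Fin (n + 1)))) =
        t • ((E.sphereMap u : Metric.sphere (0 : EuclideanSpace ℝ (Fin (n + 1))) 1) : EuclideanSpace ℝ (Fin (n + 1)))) :
    ContMDiff (𝓡∂ (n + 1)) (𝓡∂ (n + 1)) ∞ (E.ext Θ) := by
  have h1 : ContMDiffOn (𝓡∂ (n + 1)) (𝓡∂ (n + 1)) ∞ (E.psi₁ Θ) {w | g w ≤ P.A.L} := fun w hw =>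
    (E.contMDiffAt_psi₁ hΘc hΘs hΘn (lt_of_le_of_lt hw P.A.L_lt_hi)).contMDiffWithinAt
  have h2 : MapsTo (E.psi₁ Θ) {w | g w ≤ P.A.L} {w | g w ≤ P.B.L} := fun w hw => by
    show g (E.psi₁ Θ w) ≤ P.B.L
    rw [E.apply_psi₁ hΘn (lt_of_le_of_lt hw P.A.L_lt_hi), P.L_eq]; exact hw
  have h3 : ContMDiffOn (𝓡∂ (n + 1)) (𝓡∂ (n + 1)) ∞ (P.B.pull ∘ E.psi₁ Θ) {w | g w ≤ P.A.L} :=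
    P.B.contMDiffOn_pull.comp h1 h2
  have h4 : ContMDiffOn (𝓡∂ (n + 1)) (𝓡∂ (n + 1)) ∞ ((P.B.pull ∘ E.psi₁ Θ) ∘ P.A.push) univ :=
    h3.comp P.A.contMDiff_push.contMDiffOn fun x _ => P.A.apply_push_le x
  exact contMDiffOn_univ.1 h4

/-- **The extension as a diffeomorphism of `W`**, for mutually inverse halves `E`, `E'` and
mutually inverse cone data `Θ`, `Θ'`. [cite: GriffithsHB1964Handlebody, main theorem] -/
def extDiffeomorph (E' : P.swap.PreHalf χ')
    (hinv : ∀ x, g x ∈ Ioo (g P.A.p₀) P.A.hi → E'.ψ (E.ψ x) = x)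
    (hinv' : ∀ y, g y ∈ Ioo (g P.swap.A.p₀) P.swap.A.hi → E.ψ (E'.ψ y) = y)
    (Θ Θ' : EuclideanSpace ℝ (Fin (n + 1)) → EuclideanSpace ℝ (Fin (n + 1)))
    (hΘΘ' : LeftInverse Θ' Θ) (hΘ'Θ : LeftInverse Θ Θ')
    (hΘs : ContMDiff 𝓘(ℝ, EuclideanSpace ℝ (Fin (n + 1))) 𝓘(ℝ, EuclideanSpace ℝ (Fin (n + 1))) ∞ Θ)
    (hΘs' : ContMDiff 𝓘(ℝ, EuclideanSpace ℝ (Fin (n + 1))) 𝓘(ℝ, EuclideanSpace ℝ (Fin (n + 1))) ∞ Θ')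
    (hΘn : ∀ v, ‖Θ v‖ = ‖v‖) (hΘn' : ∀ v, ‖Θ' v‖ = ‖v‖)
    (hΘc : ∀ (t : ℝ) (u : Metric.sphere (0 : EuclideanSpace ℝ (Fin (n + 1))) 1), P.A.rad / 2 ≤ t → t ≤ P.A.rad →
      Θ (t • (u : EuclideanSpace ℝ (Fin (n + 1)))) =
        t • ((E.sphereMap u : Metric.sphere (0 : EuclideanSpace ℝ (Fin (n + 1))) 1) : EuclideanSpace ℝ (Fin (n + 1))))
    (hΘc' : ∀ (t : ℝ) (u : Metric.sphere (0 : EuclideanSpace ℝ (Fin (n + 1))) 1), P.swap.A.rad / 2 ≤ t → t ≤ P.swap.A.rad →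
      Θ' (t • (u : EuclideanSpace ℝ (Fin (n + 1)))) =
        t • ((E'.sphereMap u : Metric.sphere (0 : EuclideanSpace ℝ (Fin (n + 1))) 1) : EuclideanSpace ℝ (Fin (n + 1)))) :
    W ≃ₘ⟮𝓡∂ (n + 1), 𝓡∂ (n + 1)⟯ W where
  toFun := E.ext Θ
  invFun := E'.ext Θ'
  left_inv := E.ext_ext hΘn E' hinv hΘΘ'
  right_inv := E'.ext_ext hΘn' E hinv' hΘ'Θ
  contMDiff_toFun := E.contMDiff_ext hΘs hΘn hΘc
  contMDiff_invFun := E'.contMDiff_ext hΘs' hΘn' hΘc'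

/-- The extension diffeomorphism as a function. [folklore] -/
theorem coe_extDiffeomorph (E' : P.swap.PreHalf χ')
    (hinv : ∀ x, g x ∈ Ioo (g P.A.p₀) P.A.hi → E'.ψ (E.ψ x) = x)
    (hinv' : ∀ y, g y ∈ Ioo (g P.swap.A.p₀) P.swap.A.hi → E.ψ (E'.ψ y) = y)
    (Θ Θ' : EuclideanSpace ℝ (Fin (n + 1)) → EuclideanSpace ℝ (Fin (n + 1)))
    (hΘΘ' : LeftInverse Θ' Θ) (hΘ'Θ : LeftInverse Θ Θ')
    (hΘs : ContMDiff 𝓘(ℝ, EuclideanSpace ℝ (Fin (n + 1))) 𝓘(ℝ, EuclideanSpace ℝ (Fin (n + 1))) ∞ Θ)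
    (hΘs' : ContMDiff 𝓘(ℝ, EuclideanSpace ℝ (Fin (n + 1))) 𝓘(ℝ, EuclideanSpace ℝ (Fin (n + 1))) ∞ Θ')
    (hΘn : ∀ v, ‖Θ v‖ = ‖v‖) (hΘn' : ∀ v, ‖Θ' v‖ = ‖v‖)
    (hΘc : ∀ (t : ℝ) (u : Metric.sphere (0 : EuclideanSpace ℝ (Fin (n + 1))) 1), P.A.rad / 2 ≤ t → t ≤ P.A.rad →
      Θ (t • (u : EuclideanSpace ℝ (Fin (n + 1)))) =
        t • ((E.sphereMap u : Metric.sphere (0 : EuclideanSpace ℝ (Fin (n + 1))) 1) : EuclideanSpace ℝ (Fin (n + 1))))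
    (hΘc' : ∀ (t : ℝ) (u : Metric.sphere (0 : EuclideanSpace ℝ (Fin (n + 1))) 1), P.swap.A.rad / 2 ≤ t → t ≤ P.swap.A.rad →
      Θ' (t • (u : EuclideanSpace ℝ (Fin (n + 1)))) =
        t • ((E'.sphereMap u : Metric.sphere (0 : EuclideanSpace ℝ (Fin (n + 1))) 1) : EuclideanSpace ℝ (Fin (n + 1))))
    (x : W) :
    E.extDiffeomorph E' hinv hinv' Θ Θ' hΘΘ' hΘ'Θ hΘs hΘs' hΘn hΘn' hΘc hΘc' x = E.ext Θ x := rfl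

end PreHalf

end BasinPair

end Literature.Topology.FourManifolds
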